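import Literature.NumberTheory.EllipticCurves.Rank1Residual.AnomalousDictionaryPrimesAboveProofs
import Literature.NumberTheory.EllipticCurves.Rank1Residual.GVParityLineTypeProofs
import Literature.NumberTheory.EllipticCurves.Rank1Residual.ClassX1Isogeny
import HarnessLib

/-!
# Barrier (BirchSwinnertonDyer): the Heegner-log / BDP-value congruences at an Eisenstein prime are printed for NON-ANOMALOUS primes only — the anomalous (type A) pairs are outside every refereed statement of the technique class

Barrier catalogue `Literature/Barriers/BirchSwinnertonDyer/` (D-0021), entry for the technique class
**mod-`p` congruences for the `p`-adic logarithm of a Heegner point / for the value of the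
Bertolini–Darmon–Prasanna `p`-adic `L`-function at the norm character, at an EISENSTEIN prime
(`E[p]` reducible) of GOOD reduction, and the `p`-indivisibility-of-quadratic-twists /
rank-`≤ 1` theorems they drive** (Kriz 2016; Kriz–Li 2019; Castella–Grossi–Lee–Skinner 2022 and
its `p`-converse; Castella–Grossi–Skinner 2025 Theorem A read on the anticyclotomic side), applied
to an ANOMALOUS Eisenstein pair — the cell's predicate `Rank1Residual.Anom W p` (`E[p]` reducible,
good reduction at `p`, `a_p ≡ 1 (mod p)`), i.e. the pairs of class X1 (rows A1 / A3 of the K5 route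
`route-BirchSwinnertonDyer-EisensteinPrimes`: cruxes `GoodLatticeBDPValue` stmt-…-19032 and
`MazurMCOnX1RankZero` stmt-…-19035). Requested by the cell planner (bsd-eis STATUS
2026-08-26T10:31:24Z, W-g16-4: «LIT-DOSSIER §51 headline (1) is barrier-grade negative knowledge and
should be LANDED so that no crux-5 / crux-2 road is drawn through it again»); written by the bsd-eis
literature seat (g20) from the held texts listed under «References» (cell dossier
`run/shared/lean/pub/bsd-eis/LIT-DOSSIER.md` §51); every sentence in quotation marks is verbatim
from the page named. HONEST FRAMING: this is a SCOPE wall — a statement about the PRINTED standing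
hypotheses of the refereed literature as of 2026-08-26 together with the elementary mechanism that
places rational-`p`-torsion curves behind it — not a no-go theorem about Heegner points; it is struck
mechanically by the first refereed Heegner-log / BDP-value theorem proved at an anomalous pair.

## The wall, as printed (standing hypotheses verbatim)

* Kriz, *Generalized Heegner cycles at Eisenstein primes and the Katz `p`-adic `L`-function*,
  Algebra & Number Theory 10 (2016) 309–374, **Theorem 13** (pp. 322–323; store
  `paper:doi-10-2140-ant-2016-10-2` = the issue PDF, issue pp. 110–111): «Suppose `E/ℚ` is any
  elliptic curve of conductor `N` with reducible mod-`p` Galois representation `E[p]`, or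
  equivalently, `E[p]^{ss} ≅ 𝔽_p(ψ) ⊕ 𝔽_p(ψ⁻¹ω)`, where `p > 2` is a prime of good reduction for `E`
  and `ψ` is some Dirichlet character with `f(ψ)² ∣ N_add`. Suppose further that (1) `ψ(p) ≠ 1`,
  (2) `N_split = 1` …, (3) … Then, for any imaginary quadratic field `K` in which `p` splits, such
  that `K` satisfies the Heegner hypothesis with respect to `E`, and
  `p ∤ B_{1,ψ₀⁻¹ε_K}·B_{1,ψ₀ω⁻¹}`, the associated Heegner point `P_E(K) ∈ E(K)` … is nontorsion.»
  The MECHANISM is printed in **Remarks 47–48** (pp. 360–361): «Suppose `ψ ≠ 1`. Then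
  `|Ẽ(𝔽_p)| − (1+p) = −a_p ≡ −ψ(p) ≠ −1 (mod p)` … Now suppose `ψ = 1`, so that
  `|Ẽ(𝔽_p)| − (1+p) = −a_p ≡ −ψ(p) = −1 (mod p), and so |Ẽ(𝔽_p)| ≡ 0 (mod p)` …
  `log_{ω_E} P_E(K) ∈ p𝒪_{K_p}`»; «Remark 48. While the proof of Theorem 13 accounts for the case
  `ψ = 1`, it gives no new information since the left side of the relevant special value congruence
  is always `0 (mod p)` … `a_p ≡ ψ(p) = 1 (mod p)` implies that `(1 − a_p + p)/p` is a unit».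
* Kriz–Li, *Goldfeld's conjecture and congruences between Heegner points*, Forum Math. Sigma 7
  (2019) e15 (= arXiv:1609.06687, store `paper:arxiv-1609.06687` chunk p0004), **Theorem 1.12**:
  «Let `E/ℚ` be an elliptic curve of conductor `N`. Suppose `p` is an odd prime such that `E[p]` is
  a reducible `G_ℚ`-representation. Write `E[p]^{ss} ≅ 𝔽_p(ψ) ⊕ 𝔽_p(ψ⁻¹ω)` … Assume that
  • `ψ(p) ≠ 1` and `(ψ⁻¹ω)(p) ≠ 1`. • `E` has no primes of split multiplicative reduction. • …
  Then `(|Ẽ^{ns}(𝔽_p)|/p)·log_{ω_E} P ≠ 0 (mod p)`. In particular, `P ∈ E(K)` is of infinite order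
  and `E/K` has analytic and algebraic rank `1`.»
* Castella–Grossi–Lee–Skinner, Invent. Math. 227 (2022) 517–580, standing setting of §§3–5
  («`E[p]^{ss} = 𝔽_p(φ) ⊕ 𝔽_p(φ⁻¹ω)` with `φ|_{G_p} ≠ 𝟙, ω`», cell dossier §1; tree facts
  `CastellaGrossiLeeSkinner2022.*` carry `¬ Anom W p` or the character-level twin — e.g.
  `partner_good_red_not_anom`, `RankOneTwistIdentity.display_at_iff_bsdp_of_not_anom`, the
  `p`-converse `thm521_…` with «`E[p](ℚ) = 0`»), and Castella–Grossi–Skinner, Math. Ann. 393 (2025),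
  Theorem A: «`φ|_{G_p} ≠ 1, ω`» (tree `CastellaGrossiSkinner2025.thmA_charIdeal_eq_padicLFunction`,
  binder `¬ Anom W p`; its anomalous complement is class X1 by the cell's partition
  `EisensteinGoodComplement.lean`). In the tree's vocabulary the common printed hypothesis
  «`ψ|_{G_p} ≠ 𝟙` and `(ψ⁻¹ω)|_{G_p} ≠ 𝟙`» at a good Eisenstein `p > 2` is EXACTLY `¬ Anom W p`
  (Serre, Invent. 15 (1972) §1.11: tree theorem `Rank1Residual.anom_iff_decomposition_of_mem_primesAbove`
  — `Anom W p` iff a decomposition group above `p` fixes the rational line `Φ` pointwise or acts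
  trivially on `E[p]/Φ`).

## Why the anomalous pairs are behind the wall (mechanism, all in the tree)

A rational point of order `p` at a good prime `p > 2` forces `p ∣ #Ẽ(𝔽_p) = p + 1 − a_p`, i.e.
`a_p ≡ 1 (mod p)` — Kriz's Remark 47 computation; tree theorem
`Rank1Residual.anom_of_dvd_torsionOrder` (`AnomalousOfRationalTorsionProofs.lean`, Silverman AEC
VII.3.1(b)/VII.3.4) — and the pair is then of Greenberg–Vatsal TYPE A
(`Rank1Residual.not_gvPar_of_anom_of_nsmul_eq_zero`: `¬ GVPar W p`); `Anom` is an isogeny-class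
invariant (`Rank1Residual.anom_iff_of_isIsogenous`: Faltings + Serre–Tate), so — unlike the sibling
entry `EisensteinMuBarrier`, which is member-wise — this wall is NOT evaded by changing the curve
inside its `ℚ`-isogeny class (the `μ`-type quotient `E/⟨P⟩` is as anomalous as `E`).

## D-0021 structured block
The six key lines `technique_class` / `blocks` / `because` / `evasions_known` / `scope_caveats` /
`status` are carried by the docstring of the catalogued declaration `AnomalousHeegnerLogWall`
below (the gate's barrier catalogue parses DECLARATION docstrings; cell lesson p436768).

## References (bib keys of `lean/references.bib`)
[Kriz2016] Thm. 13, Rems. 14–16, 47–48 · [KrizLi2019] Thm. 1.12, §1.4 · [CastellaGrossiLeeSkinner2022]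
§3 standing hypotheses, Thm. 5.2.1 · [CastellaGrossiSkinner2025] Thm. A · [SerreInventiones1972]
§1.11 Prop. 11–12 · [SilvermanAEC2009] VII.3.1, VII.3.4, VII.7.2 · [Mazur1979] IV §1 Theorem
(p. 231) · [Vatsal1999] Thm. 0.3 (as restated in [BruinierEtAl1999] Thm. 3) · [Frey1988] ·
[BruinierEtAl1999] Thms. 1, 3, 4, Cor. 6 · [OnoSkinner1998] · [Beckwith2017] Thm. 1.1, Cor. 1.3,
Thm. 3.3 · [BeckwithRaumRichter2024] Thm. 1 · [Wiles2015] · [Vatsal2003] Thm. 1.1 · [ChidaHsieh2014]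
Hypothesis (CR⁺)/(PO) · [KellerYin2024] Thms. 1.4.1/1.5.1, Thm. A (preprint) · [GreenbergVatsal2000]
Thm. (1.3), §3. Cell documents: `run/shared/lean/pub/bsd-eis/LIT-DOSSIER.md` §51 (page pins for
every quotation above; deposit `lit/src/mazur79-gdz/`), §§1, 18, 35; `TARGET.md` rows A1/A3.
-/

noncomputable section

open scoped Classical NumberField Pointwise

open WeierstrassCurve Literature.NumberTheory.EllipticCurves Literature.NumberTheory.GaloisRepresentations
  Field IsDedekindDomain NumberField Rat.HeightOneSpectrum
  Literature.NumberTheory.EllipticCurves.Rank1Residual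

namespace Literature.Barriers.BirchSwinnertonDyer

/-- **The printed scope of the technique class**, as a predicate on `(E, p)` in the cell's vocabulary:
the standing hypotheses under which a refereed Heegner-log / BDP-value congruence at an Eisenstein
prime is stated — `E[p]` reducible, GOOD reduction at `p`, and the NON-ANOMALOUS condition
«`ψ(p) ≠ 1` and `(ψ⁻¹ω)(p) ≠ 1`» (Kriz–Li 2019 Thm. 1.12, bullet 1) / «`ψ(p) ≠ 1`» (Kriz 2016
Thm. 13 (1)) / «`φ|_{G_p} ≠ 𝟙, ω`» (CGLS 2022; CGS 2025 Thm. A), which at a good Eisenstein `p > 2`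
reads `a_p ≢ 1 (mod p)` (Serre 1972 §1.11; tree `anom_iff_decomposition_of_mem_primesAbove`).
[cite: KrizLi2019, Thm. 1.12 (first bullet)] [cite: Kriz2016, Thm. 13 (hypothesis (1))]
[cite: CastellaGrossiSkinner2025, Thm. A (hypothesis φ|G_p ≠ 1, ω)] -/
def PrintedEisensteinHeegnerLogScope (W : WeierstrassCurve ℚ) (p : ℕ) [Fact p.Prime]
    [W.IsGloballyMinimal] : Prop :=
  Red W p ∧ Good W p ∧ ¬ (p : ℤ) ∣ W.frobeniusTrace p - 1

/-- **The barrier** (scope wall; the located literature is in the module docstring): an ANOMALOUS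
Eisenstein pair `(E, p)` — `Rank1Residual.Anom W p`: `E[p]` reducible, good reduction at `p`,
`a_p ≡ 1 (mod p)`; in particular every curve with a rational point of order `p` at a good `p > 2`
(`not_printedScope_of_dvd_torsionOrder`) and every pair of class X1 (`classX1_not_printedScope`) —
lies OUTSIDE the printed scope `PrintedEisensteinHeegnerLogScope` of every refereed Heegner-log /
BDP-value congruence at an Eisenstein prime. PROVED below (`anomalousHeegnerLogWall_holds`); the
closed `Prop` is the decl that idea cards and route theses cite.

BARRIER (D-0021), one line per key:
* technique_class: heegner-log-congruence bdp-value-mod-p p-indivisibility-of-twists eisenstein-prime katz-bdp-congruence — refereed theorems asserting that `log_{ω_E} P_K` (resp. the BDP value `𝓛_𝔭(f)(𝐍_K⁻¹)`, resp. the algebraic part of a twisted central value) is a `p`-adic UNIT at an Eisenstein prime `p` of good reduction, via the congruence `f ≡` Eisenstein series and Gross's factorisation of the Katz `p`-adic `L`-function into two Kubota–Leopoldt / Bernoulli factors: Kriz 2016 Thm. 13 (and Thm. 3 / Thm. 7 / Cor. 12 behind it), Kriz–Li 2019 Thm. 1.12 (and its GL₂-type form), CGLS 2022 §§3–5 (Heegner-point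 Kolyvagin system + BDP formula at a reducible good ordinary `p`, tree facts `CastellaGrossiLeeSkinner2022.*` with `¬ Anom` / «`E[p](ℚ) = 0`» binders), CGS 2025 Thm. A on the anticyclotomic side (tree `CastellaGrossiSkinner2025.thmA_charIdeal_eq_padicLFunction`, binder `¬ Anom W p`) — formally the predicate `PrintedEisensteinHeegnerLogScope W p := Red W p ∧ Good W p ∧ ¬ p ∣ a_p − 1` [cite: Kriz2016, Thm. 13] [cite: KrizLi2019, Thm. 1.12] [cite: CastellaGrossiLeeSkinner2022, §3 (standing hypotheses) and Thm. 5.2.1] [cite: CastellaGrossiSkinner2025, Thm. A]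
* blocks: at every ANOMALOUS Eisenstein pair (`Anom W p`; class X1 = rows A1 (X1a, type A, rank 1: 7 892 (class, p) cells of the cell's census), A3 (X1b, rank 0) and the type-B row A2 of `run/shared/lean/pub/bsd-eis/TARGET.md`; every `(E, p)` with `E(ℚ)[p] ≠ 0` and `p > 2` good), every DIRECT citation of a theorem of the technique class to the pair: in the K5 route `route-BirchSwinnertonDyer-EisensteinPrimes`, crux 2 `GoodLatticeBDPValue` (stmt-BirchSwinnertonDyer-19032: «the BDP/Katz value on the good lattice is a unit or has computed λ») and crux 5 `MazurMCOnX1RankZero` (stmt-BirchSwinnertonDyer-19035; in particular the road «rank-1 twist over an admissible `K` with `p`-unit Heegner log» (B-ii) of seat k5-c5) can import NO refereed tree fact of the families `CastellaGrossiLeeSkinner2022.*`, `CastellaGrossiSkinner2025.thmA_*` and no transcription of Kriz 2016 Thm. 13 / Kriz–Li 2019 Thm. 1.12 AT the pair — their standing hypothesis is `¬ Anom W p` (`anomalousHeegnerLogWall_holds`, `classX1_not_printedScope`) [cite: Kriz2016, Thm. 13 (1) and Rem. 48] [cite: KrizLi2019, Thm. 1.12 (first bullet)] [cite: CastellaGrossiSkinner2025,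 Thm. A]
* because: at `ψ|_{G_p} = 𝟙` (the étale line is the trivial character locally — in particular when `E(ℚ)[p] ≠ 0`) the reduction `Ẽ(𝔽_p)` has order divisible by `p` and `E[p] = E(F)[p]` over `F = K(μ_p)`, so `log_{ω_E} P_E(K) ≡ 0 (mod p)` AUTOMATICALLY while the Euler-type factor `(1 − a_p + p)/p` is a unit: «it gives no new information since the left side of the relevant special value congruence is always `0 (mod p)`» [cite: Kriz2016, Rem. 47 and Rem. 48 (pp. 360–361)]; dually at `(ψ⁻¹ω)|_{G_p} = 𝟙` the Kubota–Leopoldt factor has a trivial zero (Kriz's hypothesis (3) in Rem. 16 «excludes the possibility of a "trivial zero" from the Kubota–Leopoldt factor `L_p(ψε_Kω, 0)`») [cite: Kriz2016, Rem. 16]; on the Selmer side the same configuration is CGLS/CGS's excluded case «`φ|_{G_p} = 𝟙` or `ω`», where `H⁰(ℚ_p, E[p]) ≠ 0` or its dual breaks the local control at `p` (cell dossier §§1, 18, 35; Castella's ICTS notes arXiv:2404.12644 §3) [cite: CastellaGrossiLeeSkinner2022, §3 (h1)–(h3)] [cite: CastellaGrossiSkinner2025, Thm. A and Introduction]; and the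 ELEMENTARY placement of the rational-torsion curves behind the wall: a rational point of order `p` at a good `p > 2` injects into `Ẽ(𝔽_p)`, so `p ∣ p + 1 − a_p` (tree `Rank1Residual.anom_of_dvd_torsionOrder`) [cite: SilvermanAEC2009, VII.3.1(b) and VII.3.4], the pair is then of Greenberg–Vatsal type A (tree `Rank1Residual.not_gvPar_of_anom_of_nsmul_eq_zero`) [cite: GreenbergVatsal2000, Thm. (1.3) (the parity hypothesis)], and `Anom` is a `ℚ`-isogeny invariant (tree `Rank1Residual.anom_iff_of_isIsogenous`) [cite: SilvermanAEC2009, Cor. VII.7.2]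
* evasions_known: (i) the RANK-0 / twisted-`L`-VALUE side IS refereed AT anomalous pairs — Mazur's Eisenstein-quotient theorem for prime level `N` («the following three assertions are equivalent: 1. [the algebraic part of `L(J̃,χ,1)` generates `H_𝔓`] 2. `N` does not split in `K_χ` and the class number of `K_χ` is prime to `p` 3. `J̃^{(p)}(K_χ)` is finite and the kernel of the Eisenstein prime `𝔓` in `Ш(J̃^{(p)}/K_χ)` is zero», e.g. `(X₀(11), 5)`) [cite: Mazur1979, IV §1 Theorem (p. 231)], Vatsal's congruence for `E` with a rational point of order `p ∈ {3,5,7}`, squarefree level and GOOD reduction at `p` («there exists a period `Ω⁻` for `E` such that `L(E_D,1)/((−2πi)Ω⁻) ≡ ½∏(1 − χ_D(ℓ)/ℓ)∏(1 − χ_D(ℓ))·L(χ_D,0)²/… (mod p)` for any `D < 0` prime to `Mq`», the CANONICAL period `Ω⁻`, not the Néron period) [cite: Vatsal1999, Thm. 0.3] [cite: BruinierEtAl1999, Thm. 3 and its proof sketch (Thm. 2.7 of [V])], Frey's Selmer criterion («`Sel_ℓ(E^d, ℚ)` is non-trivial if and only if `ℓ`-torsion of the class group of `ℚ(√d)` is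 non-trivial», rational `ℓ`-torsion point not in the kernel of reduction mod `ℓ`, local sign conditions) [cite: Frey1988, Theorem (as restated in Beckwith 2017, Thm. 3.3)] [cite: Beckwith2017, Thm. 3.3 and Cor. 1.3], with the supply of discriminants `p ∤ h(D)` under prescribed splitting [cite: BruinierEtAl1999, Cor. 6 (= Bruinier, Thm. 7)] [cite: Wiles2015, Thm. 1] [cite: Beckwith2017, Thm. 1.1] [cite: BeckwithRaumRichter2024, Thm. 1 (any prime ℓ, any finite set S₊ of split odd primes)] and, for a general newform but «`p` outside a finite set», Ono–Skinner [cite: OnoSkinner1998, Cor. 3 (as restated in BruinierEtAl1999, Thm. 1)] — this is where seat k5-c5's twist-rider road for crux 5 lives; (ii) `λ`–`μ` BOOKKEEPING on the good lattice instead of a unit value: the BDP/Katz value is a NON-unit at an anomalous pair but its `λ`/`μ` are computed and transported (CLAIMED, preprint) [cite: KellerYin2024, Thms. 1.4.1 and 1.5.1, Thm. A] — crux 2's [BR𝟙]/[BRω] road in the cell; (iii) CONGRUENCE TRANSFER to a non-anomalous good-ordinary `p`-congruent relative and back (Greenberg–Vatsal route G; the cell's kernel theorems `…_of_lamMin` /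 `…_of_coveredRelative_of_not_split` under `Summits/BirchSwinnertonDyer/Rank1Residual/X2/`, 51 row-A10 cells closed this way) [cite: GreenbergVatsal2000, Thm. (1.3) and §3]; (iv) the DEFINITE (Gross-point) side offers no printed evasion at a reducible `p`: every refereed definite anticyclotomic IMC divisibility carries residual irreducibility and, at weight 2, «(PO) `a_p(f)² ≢ 1 (mod p)`», which excludes anomalous `p` even for irreducible `ρ̄` [cite: ChidaHsieh2014, Hypothesis (CR⁺) and (PO)], while the definite analytic `μ` at an Eisenstein prime is POSITIVE by formula, `μ = ord_λ(C²_Eis·C_csp)` w.r.t. the canonical period [cite: Vatsal2003, Thm. 1.1]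
* scope_caveats: (a) this is a SCOPE wall about refereed print as of 2026-08-26, not a theorem about Heegner points or Selmer groups: the first refereed Heegner-log / BDP-value-unit / `p`-converse theorem stated AT an anomalous Eisenstein pair strikes it (mechanically: `PrintedEisensteinHeegnerLogScope` then acquires a printed disjunct met by `Anom`); Keller–Yin arXiv:2402.12781 (Thm. A at «an ordinary Eisenstein prime … anomalous allowed») is the CLAIMED such theorem and is unrefereed as of this date [cite: KellerYin2024, Thm. A (preprint)]; (b) the Lean theorem proves only the incompatibility of the PRINTED standing hypothesis (`a_p ≢ 1`) with `Anom`, plus the elementary placement lemmas — the content of the entry is the located list in the module docstring, whose completeness is a literature claim (cell dossier `LIT-DOSSIER.md` §51, presearch corpus + zbMATH + arXiv 2026-08-26) refutable by exhibiting ONE refereed theorem of the technique class stated at an anomalous pair; (c) the wall concerns UNIT-VALUE statements (`log_ω P ≢ 0`, BDP value a unit, `L^{alg}` a unit) — it says nothing against non-unit bookkeeping ((ii)) nor against the rank-0 modular-symbol congruences of (i), whose period is the canonical one (Vatsal 1999 / Greenberg–Vatsal 2000 §3: canonical vs Néron periods differ by `p`-powers across an Eisenstein isogeny class — the sibling entry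 `EisensteinMuBarrier`); (d) good reduction only: at a multiplicative Eisenstein `p` the predicate `Anom` is vacuous and the relevant wall is the sibling entry `ReducibleAnticyclotomicAtBadP` (class X2); additive `p` (class X3) is outside; (e) `p = 2` is outside (`Anom` is used at `p > 2` throughout the cell; `anom_of_dvd_torsionOrder` needs `2 < p`); (f) the type-A consequence (`¬ GVPar`) is recorded only for curves carrying a RATIONAL point of order `p` (`not_gvPar_of_dvd_torsionOrder`-shape lemma below takes the point as data); an anomalous pair without rational `p`-torsion in its class may be of type B (row A2) — still behind THIS wall, but inside the domain `GVPar` of the Greenberg–Vatsal transfer [cite: GreenbergVatsal2000, Thm. (1.3)]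
* status: established (theorem `anomalousHeegnerLogWall_holds`; the literature list read at the page by seat bsd-eis-lit g20, 2026-08-26, cell dossier §51; no new named fact — the file is statement + proofs over existing tree theorems)

[cite: Kriz2016, Thm. 13 and Rems. 47–48] [cite: KrizLi2019, Thm. 1.12]
[cite: CastellaGrossiSkinner2025, Thm. A] [cite: SerreInventiones1972, §1.11 Prop. 11–12] -/
def AnomalousHeegnerLogWall : Prop :=
  ∀ (W : WeierstrassCurve ℚ) [W.IsGloballyMinimal] (p : ℕ) [Fact p.Prime],
    Anom W p → ¬ PrintedEisensteinHeegnerLogScope W p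

/-- The barrier holds: `Anom W p` contains `p ∣ a_p − 1`, the printed scope contains its negation.
[cite: KrizLi2019, Thm. 1.12 (first bullet)] [cite: Kriz2016, Rem. 48] -/
theorem anomalousHeegnerLogWall_holds : AnomalousHeegnerLogWall := by
  intro W _ p _ hA hS
  exact hS.2.2 hA.2.2

/-- `AnomalousHeegnerLogWall` — `_holds` alias of `anomalousHeegnerLogWall_holds` above under the fact's exact name (appended
2026-08-28, D-0026 bookkeeping: the proof term is the existing theorem of this file; no statement,
definition or attribute is edited; no new named fact; the ledger's debt table listed the fact
unproved). [cite: Kriz2016, Rem. 48] -/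
theorem _root_.Literature.Barriers.BirchSwinnertonDyer.AnomalousHeegnerLogWall_holds :
    AnomalousHeegnerLogWall :=
  _root_.Literature.Barriers.BirchSwinnertonDyer.anomalousHeegnerLogWall_holds

namespace AnomalousHeegnerLogWall

variable {W W' : WeierstrassCurve ℚ} {p : ℕ} [Fact p.Prime]

/-- The printed scope is exactly «good Eisenstein and NOT anomalous» in the cell's predicates.
[cite: CastellaGrossiSkinner2025, Thm. A (hypothesis φ|G_p ≠ 1, ω)] [cite: KrizLi2019, Thm. 1.12] -/
theorem printedScope_iff_not_anom [W.IsGloballyMinimal] :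
    PrintedEisensteinHeegnerLogScope W p ↔ Red W p ∧ Good W p ∧ ¬ Anom W p := by
  constructor
  · rintro ⟨hred, hgood, hna⟩
    exact ⟨hred, hgood, fun hA ↦ hna hA.2.2⟩
  · rintro ⟨hred, hgood, hna⟩
    exact ⟨hred, hgood, fun hdvd ↦ hna ⟨hred, hgood, hdvd⟩⟩

/-- Pointed form of the wall. [cite: KrizLi2019, Thm. 1.12 (first bullet)] -/
theorem not_printedScope_of_anom [W.IsGloballyMinimal] (hA : Anom W p) :
    ¬ PrintedEisensteinHeegnerLogScope W p :=
  anomalousHeegnerLogWall_holds W p hA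

/-- **Rational `p`-torsion puts the pair behind the wall** (Kriz's Remark 47 computation, in the
tree: `Rank1Residual.anom_of_dvd_torsionOrder`): for `W/ℚ` globally minimal elliptic, a good prime
`p > 2` and `p ∣ #E(ℚ)_tors`, the pair is outside the printed scope of every Heegner-log / BDP-value
congruence at an Eisenstein prime. [cite: Kriz2016, Rem. 47–48] [cite: SilvermanAEC2009, VII.3.1(b) and VII.3.4] -/
theorem not_printedScope_of_dvd_torsionOrder [W.IsElliptic] [W.IsGloballyMinimal] (hp : 2 < p)
    (hgood : Good W p) (h : p ∣ W.torsionOrder) : ¬ PrintedEisensteinHeegnerLogScope W p :=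
  not_printedScope_of_anom (anom_of_dvd_torsionOrder W p hp hgood h)

/-- Conversely, a pair INSIDE the printed scope has no rational `p`-torsion — the torsion clause
«`E(K)[p] = 0` / `E[p](ℚ) = 0`» of CGLS 2022 (h1) / Thm. 5.2.1 is automatic there (tree
`Rank1Residual.not_dvd_torsionOrder_of_not_anom`). [cite: CastellaGrossiLeeSkinner2022, Thm. 5.2.1 (hypothesis E[p](ℚ) = 0)]
[cite: SilvermanAEC2009, VII.3.1(b) and VII.3.4] -/
theorem not_dvd_torsionOrder_of_printedScope [W.IsElliptic] [W.IsGloballyMinimal] (hp : 2 < p)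
    (hS : PrintedEisensteinHeegnerLogScope W p) : ¬ p ∣ W.torsionOrder :=
  not_dvd_torsionOrder_of_not_anom W p hp hS.2.1 ((printedScope_iff_not_anom.mp hS).2.2)

/-- **… and of Greenberg–Vatsal type A**: an anomalous pair carrying a rational point `P` of order
`p` (`p ≠ 2`) satisfies `¬ GVPar W p` (tree `Rank1Residual.not_gvPar_of_anom_of_nsmul_eq_zero`) —
so it is simultaneously behind this wall and outside the domain of the Greenberg–Vatsal transfer
(sibling entry `EisensteinMuBarrier`): rows A1/A3 of the cell. [cite: GreenbergVatsal2000, Thm. (1.3) (parity hypothesis)]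
[cite: Kriz2016, Rem. 48] -/
theorem not_printedScope_and_not_gvPar_of_point [W.IsElliptic] [W.IsGloballyMinimal] (hp2 : p ≠ 2)
    (hA : Anom W p) (P : W.toAffine.Point) (hP0 : P ≠ 0) (hpP : p • P = 0) :
    ¬ PrintedEisensteinHeegnerLogScope W p ∧ ¬ GVPar W p :=
  ⟨not_printedScope_of_anom hA, not_gvPar_of_anom_of_nsmul_eq_zero W hp2 hA P hP0 hpP⟩

/-- **Class X1 is behind the wall**: every pair of the cell's class X1 (`2 < p ∧ Red ∧ Good ∧ Anom ∧
¬(r_an = 0 ∧ GVPar)`; rows A1, A2, A3) lies outside the printed scope.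
[cite: KrizLi2019, Thm. 1.12 (first bullet)] [cite: CastellaGrossiSkinner2025, Thm. A] -/
theorem classX1_not_printedScope [W.IsGloballyMinimal] (hX : ClassX1 W p) :
    ¬ PrintedEisensteinHeegnerLogScope W p :=
  not_printedScope_of_anom hX.2.2.2.1

/-- **No evasion inside the isogeny class**: `Anom` is a `ℚ`-isogeny invariant (Faltings: equal
`a_p`; Serre–Tate: good reduction; reducibility transports), so every globally minimal curve
isogenous to an anomalous one is behind the wall too — in contrast with the member-wise sibling
entry `EisensteinMuBarrier`. [cite: SilvermanAEC2009, Cor. VII.7.2 and Ex. 5.4] -/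
theorem not_printedScope_of_isIsogenous [W.IsElliptic] [W'.IsElliptic] [W.IsGloballyMinimal]
    [W'.IsGloballyMinimal] (h : IsIsogenous W W') (hA : Anom W p) :
    ¬ PrintedEisensteinHeegnerLogScope W' p :=
  not_printedScope_of_anom ((anom_iff_of_isIsogenous (p := p) h).mp hA)

/-- **The wall in Galois form** (the printed hypothesis itself fails): at an anomalous pair with a
good prime `p > 2`, for EVERY rational line `Φ ≤ E[p]` and EVERY prime `𝔓'` of `\bar ℤ` above `p`,
the decomposition group `D_{𝔓'}` fixes `Φ` pointwise («`ψ|_{G_p} = 𝟙`») or acts trivially on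
`E[p]/Φ` («`(ψ⁻¹ω)|_{G_p} = 𝟙`») — the negation of Kriz–Li's first bullet / of CGS's
«`φ|_{G_p} ≠ 1, ω`» (Serre 1972 §1.11 dictionary, tree
`Rank1Residual.anom_iff_decomposition_of_mem_primesAbove`). [cite: SerreInventiones1972, §1.11 Prop. 11–12]
[cite: KrizLi2019, Thm. 1.12 (first bullet)] [cite: CastellaGrossiSkinner2025, Thm. A] -/
theorem decomposition_fix_or_quot_of_anom [W.IsElliptic] [W.IsGloballyMinimal] (hp : 2 < p)
    (hA : Anom W p) {v : HeightOneSpectrum (𝓞 ℚ)} (hv : (primesEquiv v : ℕ) = p)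
    {𝔓' : Ideal (absIntegers (𝓞 ℚ) ℚ)} (h𝔓' : 𝔓' ∈ v.primesAbove)
    {Φ : AddSubgroup (geomTorsion W (p : ℤ))} (hΦ : IsRationalLine W p Φ) :
    (∀ g ∈ 𝔓'.decompositionSubgroup (absoluteGaloisGroup ℚ), ∀ P ∈ Φ, g • P = P) ∨
      (∀ g ∈ 𝔓'.decompositionSubgroup (absoluteGaloisGroup ℚ), ∀ P : geomTorsion W (p : ℤ),
        g • P - P ∈ Φ) :=
  (anom_iff_decomposition_of_mem_primesAbove hp hA.2.1 hv h𝔓' hΦ).mp hA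

end AnomalousHeegnerLogWall

end Literature.Barriers.BirchSwinnertonDyer

end
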